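import Literature.MathematicalPhysics.QuantumFieldTheory.Balaban1983to89.B8IdxB8SubDPeriodize
import Literature.MathematicalPhysics.QuantumFieldTheory.Balaban1983to89.B8Admissible134Sep22ZdDictionary

/-!
# `Balaban1983to89.B8Admissible134Periodize` — [Balaban1985RegularSpaces] (1.3)–(1.4) p. 77 («Ω_j ⊂ T_η», «Ω_j = Bʲ(Ω_j^{(j)}), Ω_j is a sum of cubes of a size M₁Lʲη, (Lʲη)⁻¹dist(Ω_jᶜ, Ω_{j+1}) > RM₁»):
# PRINT'S LITERAL (1.3)–(1.4) CLASS `B8Eq134Admissible.Admissible134` SURVIVES PERIODISATION (the tree's `B15LatticeCubeTorus.periodize` at the constant period, tiling law `M₁·Lᵏ ∣ P`; the metric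
# clause (1.4)₃ with NO largeness condition on the period), AND THE PRINT-CLASS CUT OF THE PERIODIC (1.5)-INDEX `Node00.IdxB8SubDPer θ P` IS INHABITED AT EVERY DEPTH

statement-level skeleton of published theorems with citation tags; proofs where landed; nothing here is a claim about the Yang–Mills mass gap

T. Bałaban, *Spaces of regular gauge field configurations on a lattice and gauge fixing conditions*, Commun. Math. Phys. **99** (1985) 75–102 `[Balaban1985RegularSpaces]`
— (1.3)–(1.4) p. 77, p. 77 («we consider sequences of domains Ω_j ⊂ T_η», «The number M₁ is a size of big blocks and was fixed in [4]», «R is a sufficiently large positive integer»), Sect. F p. 98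
(«M a multiple of R₁M₁», «ρ = R₁M₁»), (1.131) p. 99.  T. Bałaban, *Propagators and renormalization transformations … II*, Commun. Math. Phys. **96** (1984) 223–250 `[Balaban1984PropagatorsII]` — (2.1)–(2.2) p. 224.

WHY (cell pub-ymgap, N05 [B8]; director-ym №217 (β′-PERIODIC) road; referee ref-L g11 SECOND-GAP notice #550 on this seat's g5 certificate `B8IdxB8SubDPrintClassGap` (the (1.5)-keyed leaf index `IdxB8SubD θ`
is STRICTLY WIDER than print's (1.3)–(1.4) class); lane word dag-n05-d g14 2026-08-28 14:01Z: exit 1 DECLARED ∕ exit 2 CUT = a Node-00 pin of the print-class sub-index `{j : IdxB8SubD(Per) θ (P) // Admissible134 θ.L M₁ R j.k j.Ω}`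
+ a token re-key, «on the (β′) road the SAME cut applies»).  Width seat dag-n05-w2 g6, CLAIM-4: the ONE kernel fact exit 2 needs on the periodic road — its sub-index is INHABITED — and the honest-scope footnote under
exit 1.  By this seat's `B8IdxB8SubDPeriodize` (p638085) every admissible tower's torus image is a member of dag-n05-w1's `IdxB8SubDPer θ P`; here the FINER class is carried through: nesting ∕ emptiness above `k`
translate-wise, `Lʲ`-block and `M₁Lʲ`-big-cube saturation because a deck translation by `P ∈ M₁Lʲℤ` permutes the cubes, and the METRIC CLAUSE (1.4)₃ unconditionally — a site outside the periodised `Ω_j` is outside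
EVERY translate of `Ω_j`, in particular the one carrying the given point of `Ω_{j+1}`, and `supDist` is translation-invariant.

WHAT IS PROVED (0 `def`, 0 sorry; std axioms):
* §1 clause-wise: `supDist_sub_right`, `mem_periodize_const_sub_iff`, `blockSat_periodize_level` (saturation by `N`-cubes survives when `N ∣ P`), `bigCubes14_periodize` (r13's `BigCubes14`, under `M₁·Lᵏ ∣ P` and
  `Ω_j = ∅` above `k`), ★ `metricClause14_periodize` (r05's `MetricClause14 supDist … 1 L R M₁`, EVERY period `P`).
* §2 ★★ `admissible134_periodize` (`Admissible134 L M₁ R k Ω → M₁·Lᵏ ∣ P → Admissible134 L M₁ R k (periodize (fun _ ↦ P) Ω)`).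
* §3 on the indices of record: ★★ `exists_idxB8SubDPer_admissible134` (`1 ≤ M₁ → θ.L ≤ R·M₁ → 1 ≤ k → 0 < P → M₁·θ.Lᵏ ∣ P → ∃ j : IdxB8SubDPer θ P, j.k = k ∧ Admissible134 θ.L M₁ R k j.Ω` — r13's
  `admissible134_cubeFam_printed` periodised through p638085's `exists_idxB8SubDPer_periodize`), `exists_idxB8SubD_admissible134_isPeriodic` (the ℤᵈ-index reading), and in dag-n06-e's (2.2) currency
  `IdxB8SubDPer.sep22Zd_of_admissible134` ∕ ★ `exists_idxB8SubDPer_admissible134_sep22Zd` (this seat's g5 dictionary `IdxB8SubD.sep22Zd_of_admissible134` at the periodic member, every truncation `m ≤ k`, every `⌈M⌉₊ ≤ M₁`).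
* §4 (v1.1, append-only): `exists_idxB8SubDPer_admissible134_eq` (the member with `Ω = periodize (fun _ ↦ P) (cubeFam true θ.L (fun _ ↦ M₁) M₁ (R·M₁) k)` named), ★ `exists_idxB8SubDPer_admissible134_nested` (its `Ω₁ ≠ ℤᵈ`
  once `θ.Lᵏ·M₁ + 2·θ.L·(R·M₁)·gs θ.L (k−1) < P` — the print-class periodic sub-family is not the all-torus tower alone).

HONEST FRAMING: set bookkeeping on `ℤᵈ` + r05 ∕ r13 ∕ p638085 ∕ p637193 ∕ p634090 BY NAME; NO estimate; nothing of Bałaban's asserted or refuted; NO κ-pin ∕ index ∕ slot typed (Node 00's pen on the director's word — this file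
is the A2 such a pin would cite); the author takes no side on DECLARE vs CUT; count-neutral; N05 NOT discharged; one finite 𝕋⁴ programme at fixed ε, Bałaban AS PRINTED — NOT continuum ∕ ℝ⁴ ∕ OS ∕ mass gap ∕ Clay.
No `sorry`, no `instance`, no `notation`. -/

noncomputable section

namespace Literature.MathematicalPhysics.QuantumFieldTheory.Balaban1983to89.B8Admissible134Periodize

open Literature.MathematicalPhysics.QuantumLattice (blockMap)
open B7Prop1Explicit B7Prop1Local
open B8LeafModelZd (ZdIdx)
open B8ConstraintBonds (DomainSeq)
open T4TermwiseTorus (IsPeriodic)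
open B15LatticeCubeTorus (periodize)
open B8IdxB8SubDPeriodize (mem_periodize_const_iff periodize_const_empty periodize_const_univ blockMap_add_mul_zsmul isPeriodic_periodize exists_idxB8SubD_periodize
  exists_idxB8SubDPer_periodize)
open B8SectAStatements (MetricClause14)
open B8Eq134Admissible (Admissible134 BigCubes14 supDist admissible134_cubeFam_printed)
open B8Eq131CubesAdmissible (cubeFam cubeFam_true_zero cubeFam_of_lt)
open B9SupplySockB9P3ZdFrame (memZd Sep22Zd)
open B8Admissible134Sep22ZdDictionary (IdxB8SubD.sep22Zd_of_admissible134)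
open Node00 (Stage3Params IdxB8SubD IdxB8SubDPer)

variable {d : ℕ}

/-! ## §1 The clauses of (1.3)–(1.4) one by one -/

section Clauses

/-- `supDist` is translation-invariant. [cite: Balaban1985RegularSpaces, (1.4) p.77 (the distance of the clause)] -/
theorem supDist_sub_right (x y v : Fin d → ℤ) : supDist (x - v) (y - v) = supDist x y := by
  simp only [supDist, Pi.sub_apply, sub_sub_sub_cancel_right]

/-- `x − P•m ∈ periodize Ω n ↔ x ∈ periodize Ω n` (the periodisation is a union of deck translates). [cite: Balaban1984PropagatorsII, (2.1) p.224] -/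
theorem mem_periodize_const_sub_iff (P : ℕ) (Ω : ℕ → Set (Fin d → ℤ)) (n : ℕ) (x m : Fin d → ℤ) :
    x - (P : ℤ) • m ∈ periodize (fun _ : Fin d => P) Ω n ↔ x ∈ periodize (fun _ : Fin d => P) Ω n :=
  B8IdxB8SubDPeriodicTowers.isPeriodic_mem_sub_iff (isPeriodic_periodize P Ω n) x m

/-- **Saturation by `N`-cubes survives periodisation when `N ∣ P`** (one level; covers both the `Lʲ`-block clause (1.4)₁ and the `M₁Lʲ`-big-cube clause (1.4)₂): a deck translation by a multiple
of `N` permutes the `N`-cubes (`blockMap_add_mul_zsmul`); the degenerate `N = 0` forces `P = 0`, where the periodisation is the identity. [cite: Balaban1985RegularSpaces, (1.4) p.77; Balaban1984PropagatorsII, (2.1) p.224] -/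
theorem blockSat_periodize_level {N P : ℕ} (hNP : N ∣ P) {Ω : ℕ → Set (Fin d → ℤ)} {n : ℕ}
    (hsat : ∀ x y : Fin d → ℤ, blockMap N x = blockMap N y → x ∈ Ω n → y ∈ Ω n) :
    ∀ x y : Fin d → ℤ, blockMap N x = blockMap N y → x ∈ periodize (fun _ : Fin d => P) Ω n → y ∈ periodize (fun _ : Fin d => P) Ω n := by
  intro x y hxy hx
  obtain ⟨m, hm⟩ := (mem_periodize_const_iff P Ω n x).1 hx
  refine (mem_periodize_const_iff P Ω n y).2 ⟨m, hsat _ _ ?_ hm⟩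
  obtain ⟨q, hq⟩ := hNP
  rcases Nat.eq_zero_or_pos N with hN | hN
  · subst hN
    have hP0 : P = 0 := by rw [hq, zero_mul]
    subst hP0
    simpa using hxy
  · have hPq : ((P : ℕ) : ℤ) = (N : ℤ) * (q : ℤ) := by rw [hq]; push_cast; ring
    have hx' : x - (P : ℤ) • m = x + ((N : ℤ) * (-(q : ℤ))) • m := by
      rw [hPq, sub_eq_add_neg, ← neg_smul]; congr 1; ring
    have hy' : y - (P : ℤ) • m = y + ((N : ℤ) * (-(q : ℤ))) • m := by
      rw [hPq, sub_eq_add_neg, ← neg_smul]; congr 1; ring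
    rw [hx', hy', blockMap_add_mul_zsmul hN, blockMap_add_mul_zsmul hN, hxy]

/-- **(1.4)₂ «Ω_j is a sum of cubes of a size M₁Lʲη» SURVIVES PERIODISATION** under the tiling law `M₁·Lᵏ ∣ P` for a tower empty above depth `k` (`M₁Lʲ ∣ M₁Lᵏ ∣ P` at `j ≤ k`; empty levels stay empty).
[cite: Balaban1985RegularSpaces, (1.4) p.77, p.77 («M₁ … was fixed in [4]»); Balaban1984PropagatorsII, (2.1)–(2.2) p.224] -/
theorem bigCubes14_periodize {L M₁ P k : ℕ} {Ω : ℕ → Set (Fin d → ℤ)} (h : BigCubes14 L M₁ Ω) (hbeyond : ∀ j, k < j → Ω j = ∅) (hdvd : M₁ * L ^ k ∣ P) :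
    BigCubes14 L M₁ (periodize (fun _ : Fin d => P) Ω) := by
  intro j x y hxy hx
  rcases Nat.lt_or_ge k j with hj | hj
  · rw [periodize_const_empty P (hbeyond j hj)] at hx
    exact absurd hx (Set.notMem_empty x)
  · exact blockSat_periodize_level ((Nat.mul_dvd_mul_left M₁ (pow_dvd_pow L hj)).trans hdvd) (h j) x y hxy hx

/-- ★ **THE METRIC CLAUSE (1.4)₃ «(Lʲη)⁻¹dist(Ω_jᶜ, Ω_{j+1}) > RM₁» SURVIVES PERIODISATION FOR EVERY PERIOD `P`** (no largeness condition): if `x ∉ Ωᴾ_j` and `y ∈ Ωᴾ_{j+1}`, pick `m` with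
`y − P•m ∈ Ω_{j+1}`; then `x − P•m ∉ Ω_j` (else `x ∈ Ωᴾ_j`), and `supDist (x − P•m) (y − P•m) = supDist x y`. [cite: Balaban1985RegularSpaces, (1.4) p.77; Balaban1984PropagatorsII, (2.2) p.224] -/
theorem metricClause14_periodize {L R M₁ k : ℕ} {Ω : ℕ → Set (Fin d → ℤ)} (h : MetricClause14 supDist Ω k 1 L R M₁) (P : ℕ) :
    MetricClause14 supDist (periodize (fun _ : Fin d => P) Ω) k 1 L R M₁ := by
  intro j hj x hx y hy
  obtain ⟨m, hm⟩ := (mem_periodize_const_iff P Ω (j + 1) y).1 hy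
  have hx' : x - (P : ℤ) • m ∉ Ω j := fun hxm => hx ((mem_periodize_const_iff P Ω j x).2 ⟨m, hxm⟩)
  have key := h j hj _ hx' _ hm
  rwa [supDist_sub_right] at key

end Clauses

/-! ## §2 Print's literal (1.3)–(1.4) class survives periodisation -/

section Admissible

/-- ★★ **`Admissible134` SURVIVES PERIODISATION UNDER THE TILING LAW `M₁·Lᵏ ∣ P`**: nesting and emptiness above `k` translate-wise (p638085), `Lʲ`-block and `M₁Lʲ`-big-cube saturation by
`blockSat_periodize_level`, the metric clause by `metricClause14_periodize` (unconditionally). [cite: Balaban1985RegularSpaces, (1.3)–(1.4) p.77, p.77 («Ω_j ⊂ T_η»); Balaban1984PropagatorsII, (2.1)–(2.2) p.224] -/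
theorem admissible134_periodize {L M₁ R k P : ℕ} {Ω : ℕ → Set (Fin d → ℤ)} (h : Admissible134 L M₁ R k Ω) (hdvd : M₁ * L ^ k ∣ P) :
    Admissible134 L M₁ R k (periodize (fun _ : Fin d => P) Ω) where
  nested n x hx := by
    obtain ⟨m, hm⟩ := (mem_periodize_const_iff P Ω (n + 1) x).1 hx
    exact (mem_periodize_const_iff P Ω n x).2 ⟨m, h.nested n hm⟩
  beyond j hj := periodize_const_empty P (h.beyond j hj)
  blockSat j := by
    rcases Nat.lt_or_ge k j with hj | hj
    · intro x y _ hx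
      rw [periodize_const_empty P (h.beyond j hj)] at hx
      exact absurd hx (Set.notMem_empty x)
    · exact blockSat_periodize_level (((pow_dvd_pow L hj).trans (dvd_mul_left _ M₁)).trans hdvd) (h.blockSat j)
  bigCubes := bigCubes14_periodize h.bigCubes h.beyond hdvd
  metric := metricClause14_periodize h.metric P

end Admissible

/-! ## §3 The print-class cut of the periodic index is inhabited at every depth -/

section Inhabited

variable (θ : Stage3Params)

/-- ★★ **THE PRINT-CLASS PERIODIC CUT IS INHABITED**: for `1 ≤ M₁`, `θ.L ≤ R·M₁`, depth `k ≥ 1`, period `P > 0` with the tiling law `M₁·θ.Lᵏ ∣ P`, the periodic (1.5)-index carries a member of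
depth `k` whose domains satisfy print's LITERAL (1.3)–(1.4) at `(M₁, R)` — print's Sect.-F tower with corner and side multiples of `M₁` and separation `ρ = R·M₁` (r13's `admissible134_cubeFam_printed`),
periodised (p638085).  The sub-index `{j : IdxB8SubDPer θ P // Admissible134 θ.L M₁ R j.k j.Ω}` is non-empty at every depth.
[cite: Balaban1985RegularSpaces, (1.3)–(1.4) p.77, p.98 («M a multiple of R₁M₁», «ρ = R₁M₁»), (1.131) p.99, p.77 («Ω_j ⊂ T_η»); Balaban1984PropagatorsII, (2.1)–(2.2) p.224] -/
theorem exists_idxB8SubDPer_admissible134 {M₁ R : ℕ} (hM₁ : 1 ≤ M₁) (hRM : θ.L ≤ R * M₁) {k : ℕ} (hk : 1 ≤ k) {P : ℕ} (hP : 0 < P)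
    (hdvd : M₁ * θ.L ^ k ∣ P) :
    ∃ j : IdxB8SubDPer θ P, j.1.1.1.1.1.k = k ∧ Admissible134 θ.L M₁ R k j.1.1.1.1.1.Ω := by
  have hL : 1 ≤ θ.L := le_trans (by norm_num) θ.two_le_L
  have hL0 : (0 : ℝ) < θ.L := by exact_mod_cast (show 0 < θ.L by omega)
  have hη : (0 : ℝ) < ((θ.L : ℝ)⁻¹) ^ k := pow_pos (inv_pos.mpr hL0) k
  have hscale : (θ.L : ℝ) ^ k * ((θ.L : ℝ)⁻¹) ^ k ≤ 1 := by
    rw [← mul_pow, mul_inv_cancel₀ hL0.ne', one_pow]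
  have hadm : Admissible134 θ.L M₁ R k (cubeFam true θ.L (fun _ : Fin θ.D => (M₁ : ℤ)) M₁ (R * M₁) k) :=
    admissible134_cubeFam_printed true hL _ M₁ k hM₁ hRM (fun _ => dvd_rfl) dvd_rfl
  obtain ⟨j, -, hjk, hΩ⟩ := exists_idxB8SubDPer_periodize θ hη hk hscale hP ((dvd_mul_left _ M₁).trans hdvd)
    (cubeFam_true_zero θ.L _ M₁ (R * M₁) k) (hadm.domainSeq hL hRM) fun n hn => cubeFam_of_lt true θ.L _ M₁ (R * M₁) hn
  exact ⟨j, hjk, by rw [hΩ]; exact admissible134_periodize hadm hdvd⟩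

/-- **The ℤᵈ-index reading**: the same member, read in `IdxB8SubD θ`, with `P`-PERIODIC domains at every level. [cite: Balaban1985RegularSpaces, (1.3)–(1.4) p.77, p.98, p.77 («Ω_j ⊂ T_η»)] -/
theorem exists_idxB8SubD_admissible134_isPeriodic {M₁ R : ℕ} (hM₁ : 1 ≤ M₁) (hRM : θ.L ≤ R * M₁) {k : ℕ} (hk : 1 ≤ k) {P : ℕ} (hP : 0 < P)
    (hdvd : M₁ * θ.L ^ k ∣ P) :
    ∃ j : IdxB8SubD θ, j.1.1.1.1.k = k ∧ Admissible134 θ.L M₁ R k j.1.1.1.1.Ω ∧ ∀ l, IsPeriodic P (· ∈ j.1.1.1.1.Ω l) := by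
  obtain ⟨j, hjk, hadm⟩ := exists_idxB8SubDPer_admissible134 θ hM₁ hRM hk hP hdvd
  exact ⟨j.1, hjk, hadm, j.periodic⟩

variable {θ}

/-- **In dag-n06-e's (2.2) currency**: a member of the periodic index satisfying print's (1.3)–(1.4) at `(M₁, R)` is `Sep22Zd R`-separated at every truncation `m ≤ k` and every `⌈M⌉₊ ≤ M₁` (this seat's g5
dictionary `IdxB8SubD.sep22Zd_of_admissible134` at `j.1`). [cite: Balaban1985RegularSpaces, (1.4) p.77; Balaban1984PropagatorsII, (2.2) p.224] -/
theorem IdxB8SubDPer.sep22Zd_of_admissible134 {P : ℕ} (j : IdxB8SubDPer θ P) {M₁ R : ℕ} (h : Admissible134 θ.L M₁ R j.1.1.1.1.1.k j.1.1.1.1.1.Ω)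
    {m : ℕ} (hm : m ≤ j.1.1.1.1.1.k) {M : ℝ} (hM : ⌈M⌉₊ ≤ M₁) : Sep22Zd R (memZd M j.1.1.1.1.1 m) :=
  IdxB8SubD.sep22Zd_of_admissible134 j.1 h hm hM

variable (θ)

/-- ★ **THE PRINT-CLASS PERIODIC MEMBER IN BOTH CURRENCIES AT ONCE**: depth `k`, print's (1.3)–(1.4) at `(M₁, R)`, and [B6] (2.2) `Sep22Zd R` at every truncation `m ≤ k` for every `⌈M⌉₊ ≤ M₁` — what a
κ-cut keyed on either predicate would cite for A2 on the (β′) road. [cite: Balaban1985RegularSpaces, (1.3)–(1.4) p.77, p.98; Balaban1984PropagatorsII, (2.2) p.224] -/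
theorem exists_idxB8SubDPer_admissible134_sep22Zd {M₁ R : ℕ} (hM₁ : 1 ≤ M₁) (hRM : θ.L ≤ R * M₁) {k : ℕ} (hk : 1 ≤ k) {P : ℕ} (hP : 0 < P)
    (hdvd : M₁ * θ.L ^ k ∣ P) :
    ∃ j : IdxB8SubDPer θ P, j.1.1.1.1.1.k = k ∧ Admissible134 θ.L M₁ R k j.1.1.1.1.1.Ω ∧
      ∀ m, m ≤ k → ∀ M : ℝ, ⌈M⌉₊ ≤ M₁ → Sep22Zd R (memZd M j.1.1.1.1.1 m) := by
  obtain ⟨j, hjk, hadm⟩ := exists_idxB8SubDPer_admissible134 θ hM₁ hRM hk hP hdvd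
  refine ⟨j, hjk, hadm, fun m hm M hM => ?_⟩
  exact IdxB8SubDPer.sep22Zd_of_admissible134 j (hjk.symm ▸ hadm) (hjk.symm ▸ hm) hM

end Inhabited

/-! ## §4 (v1.1, APPEND-ONLY) The print-class periodic member with its domains EXPOSED, and its non-triviality: not the all-torus tower once the torus is wider than `□₁`
(A6 footnote for a κ-cut row: print ADMITS `Ω_j = T_η`, so the all-torus tower is also print-class — the class is nevertheless not a one-member class) -/

section Nested

variable (θ : Stage3Params)

/-- **The print-class periodic member of `exists_idxB8SubDPer_admissible134` WITH ITS DOMAINS NAMED**: `Ω = periodize (fun _ ↦ P) (cubeFam true θ.L (fun _ ↦ M₁) M₁ (R·M₁) k)` — print's Sect.-F tower at corner `M₁·𝟙`,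
side `M₁`, separation `R·M₁`, periodised. [cite: Balaban1985RegularSpaces, (1.3)–(1.4) p.77, p.98 («M a multiple of R₁M₁», «ρ = R₁M₁»), (1.131) p.99; Balaban1984PropagatorsII, (2.1)–(2.2) p.224] -/
theorem exists_idxB8SubDPer_admissible134_eq {M₁ R : ℕ} (hM₁ : 1 ≤ M₁) (hRM : θ.L ≤ R * M₁) {k : ℕ} (hk : 1 ≤ k) {P : ℕ} (hP : 0 < P)
    (hdvd : M₁ * θ.L ^ k ∣ P) :
    ∃ j : IdxB8SubDPer θ P, j.1.1.1.1.1.k = k ∧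
      j.1.1.1.1.1.Ω = periodize (fun _ : Fin θ.D => P) (cubeFam true θ.L (fun _ : Fin θ.D => (M₁ : ℤ)) M₁ (R * M₁) k) ∧
      Admissible134 θ.L M₁ R k j.1.1.1.1.1.Ω := by
  have hL : 1 ≤ θ.L := le_trans (by norm_num) θ.two_le_L
  have hL0 : (0 : ℝ) < θ.L := by exact_mod_cast (show 0 < θ.L by omega)
  have hη : (0 : ℝ) < ((θ.L : ℝ)⁻¹) ^ k := pow_pos (inv_pos.mpr hL0) k
  have hscale : (θ.L : ℝ) ^ k * ((θ.L : ℝ)⁻¹) ^ k ≤ 1 := by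
    rw [← mul_pow, mul_inv_cancel₀ hL0.ne', one_pow]
  have hadm : Admissible134 θ.L M₁ R k (cubeFam true θ.L (fun _ : Fin θ.D => (M₁ : ℤ)) M₁ (R * M₁) k) :=
    admissible134_cubeFam_printed true hL _ M₁ k hM₁ hRM (fun _ => dvd_rfl) dvd_rfl
  obtain ⟨j, -, hjk, hΩ⟩ := exists_idxB8SubDPer_periodize θ hη hk hscale hP ((dvd_mul_left _ M₁).trans hdvd)
    (cubeFam_true_zero θ.L _ M₁ (R * M₁) k) (hadm.domainSeq hL hRM) fun n hn => cubeFam_of_lt true θ.L _ M₁ (R * M₁) hn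
  exact ⟨j, hjk, hΩ, by rw [hΩ]; exact admissible134_periodize hadm hdvd⟩

/-- ★ **THE PRINT-CLASS PERIODIC SUB-FAMILY CONTAINS A GENUINELY NESTED TOWER** (`0 < θ.D`; torus wider than `□₁`: `θ.Lᵏ·M₁ + 2·θ.L·(R·M₁)·gs θ.L (k−1) < P`): a member of `IdxB8SubDPer θ P` of depth `k`
satisfying print's (1.3)–(1.4) at `(M₁, R)` whose `Ω₁` is a PROPER subset of `ℤᵈ` — so a κ-cut row is not answered by the all-torus tower alone (p638085's `periodize_cubeFam_one_ne_univ`).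
[cite: Balaban1985RegularSpaces, (1.3)–(1.4) p.77, Sect. F p.98 («□ ⊂ T_η»), (1.131) p.99; Balaban1984PropagatorsII, (2.1)–(2.2) p.224] -/
theorem exists_idxB8SubDPer_admissible134_nested (hD : 0 < θ.D) {M₁ R : ℕ} (hM₁ : 1 ≤ M₁) (hRM : θ.L ≤ R * M₁) {k : ℕ} (hk : 1 ≤ k) {P : ℕ} (hP : 0 < P)
    (hdvd : M₁ * θ.L ^ k ∣ P) (hwide : ((θ.L : ℤ) ^ k) * M₁ + 2 * ((θ.L : ℤ) * ((R * M₁) * B8Eq131Cubes.gs θ.L (k - 1) : ℕ)) < (P : ℤ)) :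
    ∃ j : IdxB8SubDPer θ P, j.1.1.1.1.1.k = k ∧ Admissible134 θ.L M₁ R k j.1.1.1.1.1.Ω ∧ j.1.1.1.1.1.Ω 1 ≠ Set.univ := by
  obtain ⟨j, hjk, hΩ, hadm⟩ := exists_idxB8SubDPer_admissible134_eq θ hM₁ hRM hk hP hdvd
  refine ⟨j, hjk, hadm, ?_⟩
  rw [hΩ]
  exact B8IdxB8SubDPeriodize.periodize_cubeFam_one_ne_univ hk hD hwide

end Nested

end Literature.MathematicalPhysics.QuantumFieldTheory.Balaban1983to89.B8Admissible134Periodize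

end
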